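import Literature.NumberTheory.EllipticCurves.Gamma0CosetP1
import Mathlib.Data.ZMod.Units
import Mathlib.FieldTheory.Finite.Basic
import Mathlib.Data.Int.Cast.Prod
import Literature.NumberTheory.EllipticCurves.ModularCurveGamma0IndexProofs
import HarnessLib

/-!
# Fixed points of Hecke matrices on `ℙ¹(ℤ/Nℤ)` (squarefree level)

For an integer matrix `M` with `det M` prime to the squarefree level `N`, the number of fixed
points of `[M̄]` on `X = SL₂(ℤ)/Γ₀(N) ≅ ℙ¹(ℤ/Nℤ)` (the diagonal of the permutation matrix through
which `M` enters Popa's operator `𝔗_ξ` on `ℚ^X`) is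

  `Fix_N(M) = ∏_{ℓ ∣ N} r_ℓ(t, n) · (ℓ + 1 if M ≡ scalar (mod ℓ), else 1)`,

`t = tr M`, `n = det M`, `r_ℓ(t, n) = #{x ∈ 𝔽_ℓ : x² − t x + n = 0}` (the local factors of the
Eichler–Selberg / Schoof–van der Vlugt densities `μ(t, f, n)`).  Proof: `φ(N) · Fix_N(M)` counts
the pairs `(v, λ)` of a unimodular column and a unit with `M̄ v = λ v` (`eigPairs`), which is
multiplicative in `N` (Chinese remainder theorem) and equals `(ℓ − 1) r_ℓ(t, n) (ℓ + 1 | 1)` for a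
prime `ℓ` (affine chart `[u : 1]`, `[1 : 0]` of `ℙ¹(𝔽_ℓ)`: the fixed points `[u : 1]` are the roots
of `c u² + (d − a) u − b`, in bijection with the roots of `Y² − tY + n` via `Y = c u + d` when
`c ≠ 0`).

## References
* [SchoofVandervlugt1991] R. Schoof, M. van der Vlugt, *Hecke operators and the weight
  distributions of certain codes*, J. Combin. Theory A 57 (1991), Thm. 2.2 (the densities μ).
* [Popa2014] A. Popa, Res. Math. Sci. 5 (2018), §2 (`tr(T̃|V) = ∑ ε(X) tr(V|M_X)`).
-/

noncomputable section

open scoped MatrixGroups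
open Matrix

namespace Literature.NumberTheory.EllipticCurves.ModularForms

/-! ### Eigen-pairs `(v, λ)` over a finite commutative ring -/

/-- The number of **eigen-pairs** of `A ∈ M₂(R)`: pairs `(v, λ)` of a unimodular column
`v ∈ R²` and a unit `λ ∈ Rˣ` with `A v = λ v`. [folklore] -/
def eigPairs (R : Type*) [CommRing R] (A : Matrix (Fin 2) (Fin 2) R) : ℕ :=
  Nat.card {p : (Fin 2 → R) × Rˣ // IsCoprime (p.1 0) (p.1 1) ∧ A *ᵥ p.1 = (p.2 : R) • p.1}

/-- The number of roots of `x² − t x + n` in `R` (for `R = 𝔽_ℓ`: the local factor `r_ℓ(t, n)`).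
[cite: SchoofVandervlugt1991, Thm. 2.2 (μ(t, f, n))] -/
def rootCount (R : Type*) [CommRing R] (t n : R) : ℕ :=
  Nat.card {x : R // x ^ 2 - t * x + n = 0}

/-- `rootCount` as a filtered cardinality. [folklore] -/
theorem rootCount_eq_card_filter (R : Type*) [CommRing R] [Fintype R] [DecidableEq R] (t n : R) :
    rootCount R t n = (Finset.univ.filter fun x : R => x ^ 2 - t * x + n = 0).card := by
  rw [rootCount, Nat.card_eq_fintype_card, Fintype.card_subtype]

section Prime

variable {p : ℕ} [Fact p.Prime]

/-- Over a field, a column is unimodular iff it is nonzero. [folklore] -/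
theorem isCoprime_iff_ne_zero {K : Type*} [Field K] (v : Fin 2 → K) :
    IsCoprime (v 0) (v 1) ↔ v ≠ 0 := by
  constructor
  · intro h hv
    rw [hv] at h
    simp at h
  · intro hv
    by_cases h0 : v 0 = 0
    · have h1 : v 1 ≠ 0 := fun h1 => hv (by ext i; fin_cases i <;> simp [h0, h1])
      exact ⟨0, (v 1)⁻¹, by simp [h1]⟩
    · exact ⟨(v 0)⁻¹, 0, by simp [h0]⟩

/-- The affine root count `#{u : c u² + (d − a) u − b = 0} + [c = 0]` of fixed points of
`(a b; c d)` on `ℙ¹(𝔽_p)` (`[u : 1]` fixed iff `c u² + (d − a) u − b = 0`; `[1 : 0]` fixed iff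
`c = 0`). [folklore] -/
def affFix (A : Matrix (Fin 2) (Fin 2) (ZMod p)) : ℕ :=
  (Finset.univ.filter fun u : ZMod p => A 1 0 * u ^ 2 + (A 1 1 - A 0 0) * u - A 0 1 = 0).card +
    (if A 1 0 = 0 then 1 else 0)

/-- The eigen-pair condition in coordinates. [folklore] -/
theorem mulVec_eq_smul_iff (A : Matrix (Fin 2) (Fin 2) (ZMod p)) (v : Fin 2 → ZMod p) (l : ZMod p) :
    A *ᵥ v = l • v ↔ A 0 0 * v 0 + A 0 1 * v 1 = l * v 0 ∧ A 1 0 * v 0 + A 1 1 * v 1 = l * v 1 := by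
  have h : A *ᵥ v = ![A 0 0 * v 0 + A 0 1 * v 1, A 1 0 * v 0 + A 1 1 * v 1] := by
    ext i; fin_cases i <;> simp [Matrix.mulVec, dotProduct, Fin.sum_univ_two]
  rw [h]
  constructor
  · intro h'
    exact ⟨by simpa using congrFun h' 0, by simpa using congrFun h' 1⟩
  · rintro ⟨h0, h1⟩
    ext i; fin_cases i
    · simpa using h0
    · simpa using h1

/-- **Eigen-pairs over `𝔽_p`**: `eigPairs 𝔽_p A = (p − 1) · affFix A` for `det A ≠ 0`
(split the nonzero eigenvectors `v` by `v₁ = 0` — then `c = 0`, `λ = a`, `v₀ ∈ 𝔽_pˣ` — and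
`v₁ ≠ 0` — then `u = v₀/v₁` is a root and `λ = c u + d`). [folklore] -/
theorem eigPairs_prime (A : Matrix (Fin 2) (Fin 2) (ZMod p)) (hA : A.det ≠ 0) :
    eigPairs (ZMod p) A = (p - 1) * affFix A := by
  have hdet : A 0 0 * A 1 1 - A 0 1 * A 1 0 ≠ 0 := by rwa [Matrix.det_fin_two] at hA
  let P : Type := {q : (Fin 2 → ZMod p) × (ZMod p)ˣ // IsCoprime (q.1 0) (q.1 1) ∧ A *ᵥ q.1 = (q.2 : ZMod p) • q.1}
  have hcond := mulVec_eq_smul_iff A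
  -- a nonzero `v` with `v₁ = 0` has `v₀ ≠ 0`
  have hv0_of : ∀ v : Fin 2 → ZMod p, IsCoprime (v 0) (v 1) → v 1 = 0 → v 0 ≠ 0 := fun v hvc hv1 h =>
    ((isCoprime_iff_ne_zero _).mp hvc) (by ext i; fin_cases i <;> simp [h, hv1])
  -- split by `v₁ = 0`
  have hsplit : Nat.card P = Nat.card {q : P // q.1.1 1 = 0} + Nat.card {q : P // ¬ q.1.1 1 = 0} := by
    rw [← Nat.card_sum]
    exact Nat.card_congr (Equiv.sumCompl fun q : P => q.1.1 1 = 0).symm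
  -- `v₁ = 0`: `c = 0`, `λ = a`, `v₀` a unit
  have h0 : Nat.card {q : P // q.1.1 1 = 0} = if A 1 0 = 0 then p - 1 else 0 := by
    split_ifs with hc
    · have ha : A 0 0 ≠ 0 := by
        intro ha; apply hdet; rw [ha, hc]; ring
      rw [← ZMod.card_units p, ← Nat.card_eq_fintype_card]
      refine Nat.card_congr
        { toFun := fun q => Units.mk0 (q.1.1.1 0) (hv0_of _ q.1.2.1 q.2)
          invFun := fun x => ⟨⟨(![(x : ZMod p), 0], Units.mk0 (A 0 0) ha),
              (isCoprime_iff_ne_zero _).mpr (fun h => x.ne_zero (by simpa using congrFun h 0)),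
              (hcond _ _).mpr (by simp [hc])⟩, rfl⟩
          left_inv := fun q => ?_
          right_inv := fun x => Units.ext (by simp) }
      obtain ⟨⟨⟨v, l⟩, hvc, hvl⟩, hv1⟩ := q
      simp only at hv1 hvc hvl
      obtain ⟨e0, -⟩ := (hcond v l).mp hvl
      rw [hv1, mul_zero, add_zero] at e0
      have hl : (l : ZMod p) = A 0 0 := mul_right_cancel₀ (hv0_of v hvc hv1) e0.symm
      apply Subtype.ext; apply Subtype.ext
      refine Prod.ext ?_ (Units.ext ?_)
      · ext i; fin_cases i
        · simp
        · simp [hv1]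
      · simpa using hl.symm
    · rw [Nat.card_eq_zero]
      left
      refine ⟨fun q => ?_⟩
      obtain ⟨⟨⟨v, l⟩, hvc, hvl⟩, hv1⟩ := q
      simp only at hv1 hvc hvl
      obtain ⟨-, e1⟩ := (hcond v l).mp hvl
      rw [hv1, mul_zero, add_zero, mul_zero] at e1
      exact hc ((mul_eq_zero.mp e1).resolve_right (hv0_of v hvc hv1))
  -- `v₁ ≠ 0`: `u = v₀ / v₁` is a root, `λ = c u + d`
  have hroot : ∀ (v : Fin 2 → ZMod p) (l : ZMod p), v 1 ≠ 0 → A *ᵥ v = l • v →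
      (l = A 1 0 * (v 0 / v 1) + A 1 1) ∧
        A 1 0 * (v 0 / v 1) ^ 2 + (A 1 1 - A 0 0) * (v 0 / v 1) - A 0 1 = 0 := by
    intro v l hv1 hvl
    obtain ⟨e0, e1⟩ := (hcond v l).mp hvl
    have hl : l = A 1 0 * (v 0 / v 1) + A 1 1 := by
      have : l * v 1 = (A 1 0 * (v 0 / v 1) + A 1 1) * v 1 := by
        rw [add_mul, mul_assoc, div_mul_cancel₀ _ hv1]; linear_combination -e1
      exact mul_right_cancel₀ hv1 this
    refine ⟨hl, ?_⟩
    have h2 : (A 1 0 * (v 0 / v 1) ^ 2 + (A 1 1 - A 0 0) * (v 0 / v 1) - A 0 1) * (v 1 * v 1) = 0 := by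
      have ev : v 0 / v 1 * v 1 = v 0 := div_mul_cancel₀ _ hv1
      rw [hl] at e0
      linear_combination (A 1 0 * (v 0 / v 1 * v 1 + v 0) + (A 1 1 - A 0 0) * v 1 - A 1 0 * v 0) * ev -
        v 1 * e0
    rcases mul_eq_zero.mp h2 with h | h
    · exact h
    · exact absurd (mul_self_eq_zero.mp h) hv1
  have h1 : Nat.card {q : P // ¬ q.1.1 1 = 0} =
      Nat.card {u : ZMod p // A 1 0 * u ^ 2 + (A 1 1 - A 0 0) * u - A 0 1 = 0} * (p - 1) := by
    rw [← ZMod.card_units p, ← Nat.card_eq_fintype_card, ← Nat.card_prod]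
    -- the eigenvalue `c u + d` of a root is nonzero
    have hunit : ∀ u : ZMod p, A 1 0 * u ^ 2 + (A 1 1 - A 0 0) * u - A 0 1 = 0 → A 1 0 * u + A 1 1 ≠ 0 := by
      intro u hu h
      apply hdet
      have hab : A 0 0 * u + A 0 1 = (A 1 0 * u + A 1 1) * u := by linear_combination -hu
      rw [h, zero_mul] at hab
      have e2 : A 0 0 * A 1 1 - A 0 1 * A 1 0 = A 0 0 * (A 1 0 * u + A 1 1) - A 1 0 * (A 0 0 * u + A 0 1) := by
        ring
      rw [e2, h, hab]; ring
    refine Nat.card_congr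
      { toFun := fun q => (⟨q.1.1.1 0 / q.1.1.1 1, (hroot _ _ q.2 q.1.2.2).2⟩, Units.mk0 (q.1.1.1 1) q.2)
        invFun := fun y => ⟨⟨(![(y.1 : ZMod p) * y.2, y.2], Units.mk0 (A 1 0 * y.1 + A 1 1) (hunit y.1 y.1.2)),
            (isCoprime_iff_ne_zero _).mpr (fun h => y.2.ne_zero (by simpa using congrFun h 1)),
            (hcond _ _).mpr ⟨?_, ?_⟩⟩, by simp⟩
        left_inv := fun q => ?_
        right_inv := fun y => ?_ }
    · simp only [Matrix.cons_val_zero, Matrix.cons_val_one, Units.val_mk0]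
      linear_combination (-(y.2 : ZMod p)) * y.1.2
    · simp only [Matrix.cons_val_zero, Matrix.cons_val_one, Units.val_mk0]
      ring
    · obtain ⟨⟨⟨v, l⟩, hvc, hvl⟩, hv1⟩ := q
      simp only at hv1 hvc hvl
      obtain ⟨hl, -⟩ := hroot v l hv1 hvl
      apply Subtype.ext; apply Subtype.ext
      refine Prod.ext ?_ (Units.ext ?_)
      · ext i; fin_cases i
        · simp only [Units.val_mk0]; exact div_mul_cancel₀ _ hv1
        · simp
      · simp only [Units.val_mk0]; exact hl.symm
    · obtain ⟨⟨u, hu⟩, w⟩ := y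
      refine Prod.ext (Subtype.ext ?_) (Units.ext ?_)
      · simp only [Matrix.cons_val_zero, Matrix.cons_val_one]
        exact mul_div_cancel_right₀ _ w.ne_zero
      · simp
  unfold eigPairs affFix
  rw [show Nat.card P = _ from hsplit, h0, h1, Nat.card_eq_fintype_card, Fintype.card_subtype]
  split_ifs <;> ring

/-- The roots of `(x − a)(x − d)`: `1` if `a = d`, else `2`. [folklore] -/
theorem rootCount_split (a d : ZMod p) :
    rootCount (ZMod p) (a + d) (a * d) = if a = d then 1 else 2 := by
  rw [rootCount_eq_card_filter]
  have hset : (Finset.univ.filter fun x : ZMod p => x ^ 2 - (a + d) * x + a * d = 0) = {a, d} := by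
    ext x
    simp only [Finset.mem_filter, Finset.mem_univ, true_and, Finset.mem_insert, Finset.mem_singleton]
    rw [show x ^ 2 - (a + d) * x + a * d = (x - a) * (x - d) by ring, mul_eq_zero, sub_eq_zero, sub_eq_zero]
  rw [hset]
  split_ifs with h
  · subst h; simp
  · exact Finset.card_pair h

/-- **The affine fixed-point count in terms of the characteristic polynomial**:
`affFix A = r_p(tr A, det A) · (p + 1 if A is scalar, else 1)`
(`Y = c u + d` when `c ≠ 0`; direct inspection when `c = 0`). [folklore] -/
theorem affFix_eq (A : Matrix (Fin 2) (Fin 2) (ZMod p)) :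
    affFix A = rootCount (ZMod p) (A 0 0 + A 1 1) A.det *
      (if A 1 0 = 0 ∧ A 0 1 = 0 ∧ A 0 0 = A 1 1 then p + 1 else 1) := by
  rw [Matrix.det_fin_two]
  unfold affFix
  by_cases hc : A 1 0 = 0
  · -- `c = 0`
    rw [if_pos hc, show A 0 0 * A 1 1 - A 0 1 * A 1 0 = A 0 0 * A 1 1 by rw [hc]; ring, rootCount_split]
    by_cases had : A 0 0 = A 1 1
    · by_cases hb : A 0 1 = 0
      · -- scalar
        rw [if_pos had, if_pos ⟨hc, hb, had⟩]
        have : (Finset.univ.filter fun u : ZMod p => A 1 0 * u ^ 2 + (A 1 1 - A 0 0) * u - A 0 1 = 0) =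
            Finset.univ := by
          ext u; simp [hc, hb, had]
        rw [this, Finset.card_univ, ZMod.card, one_mul]
      · rw [if_pos had, if_neg (fun h => hb h.2.1)]
        have : (Finset.univ.filter fun u : ZMod p => A 1 0 * u ^ 2 + (A 1 1 - A 0 0) * u - A 0 1 = 0) = ∅ := by
          ext u; simp [hc, hb, had]
        rw [this, Finset.card_empty]
    · rw [if_neg had, if_neg (fun h => had h.2.2)]
      have hda : A 1 1 - A 0 0 ≠ 0 := sub_ne_zero.mpr (Ne.symm had)
      have : (Finset.univ.filter fun u : ZMod p => A 1 0 * u ^ 2 + (A 1 1 - A 0 0) * u - A 0 1 = 0) =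
          {A 0 1 / (A 1 1 - A 0 0)} := by
        ext u
        simp only [Finset.mem_filter, Finset.mem_univ, true_and, Finset.mem_singleton, hc, zero_mul, zero_add]
        rw [sub_eq_zero, eq_div_iff hda, mul_comm]
      rw [this, Finset.card_singleton]
  · -- `c ≠ 0`: `u ↦ c u + d`
    rw [if_neg hc, if_neg (fun h => hc h.1), add_zero, mul_one, rootCount_eq_card_filter]
    refine Finset.card_nbij' (fun u => A 1 0 * u + A 1 1) (fun x => (x - A 1 1) / A 1 0) (fun u hu => ?_)
      (fun x hx => ?_)
      (fun u _ => by show (A 1 0 * u + A 1 1 - A 1 1) / A 1 0 = u; rw [add_sub_cancel_right, mul_comm, mul_div_cancel_right₀ _ hc])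
      (fun x _ => by show A 1 0 * ((x - A 1 1) / A 1 0) + A 1 1 = x; rw [mul_comm, div_mul_cancel₀ _ hc, sub_add_cancel])
    · simp only [Finset.mem_coe, Finset.mem_filter, Finset.mem_univ, true_and] at hu ⊢
      linear_combination A 1 0 * hu
    · simp only [Finset.mem_coe, Finset.mem_filter, Finset.mem_univ, true_and] at hx ⊢
      have e : A 1 0 * ((x - A 1 1) / A 1 0) ^ 2 + (A 1 1 - A 0 0) * ((x - A 1 1) / A 1 0) - A 0 1 =
          (x ^ 2 - (A 0 0 + A 1 1) * x + (A 0 0 * A 1 1 - A 0 1 * A 1 0)) / A 1 0 := by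
        field_simp
        ring
      rw [e, hx, zero_div]

end Prime

/-! ### Chinese remainder theorem for eigen-pairs -/

section CRT

/-- The eigen-pair condition is preserved by ring homomorphisms (for integer matrices).
[folklore] -/
theorem mulVec_eq_smul_map {R S : Type*} [CommRing R] [CommRing S] (f : R →+* S)
    (A : Matrix (Fin 2) (Fin 2) ℤ) {v : Fin 2 → R} {l : R}
    (h : A.map (Int.cast : ℤ → R) *ᵥ v = l • v) :
    A.map (Int.cast : ℤ → S) *ᵥ (f ∘ v) = f l • (f ∘ v) := by
  have hf : (f ∘ (Int.cast : ℤ → R)) = (Int.cast : ℤ → S) := funext fun z => map_intCast f z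
  ext i
  have h1 := RingHom.map_mulVec f (A.map (Int.cast : ℤ → R)) v i
  rw [Matrix.map_map, hf] at h1
  rw [← h1, h]
  simp

/-- **Eigen-pairs are multiplicative along a ring isomorphism `R ≃ S × T`** (Chinese remainder
theorem: unimodularity, units and `A v = λ v` are all componentwise). [folklore] -/
theorem eigPairs_of_ringEquiv_prod {R S T : Type*} [CommRing R] [CommRing S] [CommRing T]
    (e : R ≃+* S × T) (A : Matrix (Fin 2) (Fin 2) ℤ) :
    eigPairs R (A.map (Int.cast : ℤ → R)) =
      eigPairs S (A.map (Int.cast : ℤ → S)) * eigPairs T (A.map (Int.cast : ℤ → T)) := by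
  unfold eigPairs
  rw [← Nat.card_prod]
  set fS : R →+* S := (RingHom.fst S T).comp e.toRingHom
  set fT : R →+* T := (RingHom.snd S T).comp e.toRingHom
  have he : ∀ x : R, e x = (fS x, fT x) := fun x => rfl
  have hinv : ∀ (y : S) (z : T), fS (e.symm (y, z)) = y ∧ fT (e.symm (y, z)) = z := fun y z => by
    constructor
    · show (e (e.symm (y, z))).1 = y; rw [e.apply_symm_apply]
    · show (e (e.symm (y, z))).2 = z; rw [e.apply_symm_apply]
  -- coprimality transfers
  have hcop : ∀ {a c : R}, IsCoprime a c ↔ IsCoprime (fS a) (fS c) ∧ IsCoprime (fT a) (fT c) := by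
    intro a c
    rw [show (IsCoprime (fS a) (fS c) ∧ IsCoprime (fT a) (fT c)) ↔ IsCoprime (e a) (e c) from
      (isCoprime_prod_iff (x := e a) (y := e c)).symm]
    constructor
    · exact fun h => h.map e.toRingHom
    · intro h
      have := h.map e.symm.toRingHom
      simpa using this
  -- the eigen-condition transfers back along `e.symm`
  have hback : ∀ (w₁ : Fin 2 → S) (w₂ : Fin 2 → T) (l₁ : S) (l₂ : T),
      A.map (Int.cast : ℤ → S) *ᵥ w₁ = l₁ • w₁ → A.map (Int.cast : ℤ → T) *ᵥ w₂ = l₂ • w₂ →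
      A.map (Int.cast : ℤ → R) *ᵥ (fun i => e.symm (w₁ i, w₂ i)) =
        e.symm (l₁, l₂) • (fun i => e.symm (w₁ i, w₂ i)) := by
    intro w₁ w₂ l₁ l₂ h₁ h₂
    have h12 : A.map (Int.cast : ℤ → S × T) *ᵥ (fun i => (w₁ i, w₂ i)) =
        ((l₁, l₂) : S × T) • (fun i => (w₁ i, w₂ i)) := by
      ext i
      · have := congrFun h₁ i
        simp only [Matrix.mulVec, dotProduct, Fin.sum_univ_two, Matrix.map_apply, Pi.smul_apply,
          smul_eq_mul] at this ⊢
        simpa using this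
      · have := congrFun h₂ i
        simp only [Matrix.mulVec, dotProduct, Fin.sum_univ_two, Matrix.map_apply, Pi.smul_apply,
          smul_eq_mul] at this ⊢
        simpa using this
    have := mulVec_eq_smul_map e.symm.toRingHom A h12
    simpa [Function.comp_def] using this
  refine Nat.card_congr
    { toFun := fun q => (⟨(fS ∘ q.1.1, Units.map fS.toMonoidHom q.1.2), (hcop.mp q.2.1).1,
          mulVec_eq_smul_map fS A q.2.2⟩,
        ⟨(fT ∘ q.1.1, Units.map fT.toMonoidHom q.1.2), (hcop.mp q.2.1).2, mulVec_eq_smul_map fT A q.2.2⟩)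
      invFun := fun y => ⟨(fun i => e.symm (y.1.1.1 i, y.2.1.1 i),
          ⟨e.symm ((y.1.1.2 : S), (y.2.1.2 : T)), e.symm ((↑y.1.1.2⁻¹ : S), (↑y.2.1.2⁻¹ : T)), ?_, ?_⟩), ?_, ?_⟩
      left_inv := fun q => ?_
      right_inv := fun y => ?_ }
  · rw [← map_mul, Prod.mk_mul_mk, Units.mul_inv, Units.mul_inv, ← Prod.one_eq_mk, map_one]
  · rw [← map_mul, Prod.mk_mul_mk, Units.inv_mul, Units.inv_mul, ← Prod.one_eq_mk, map_one]
  · simp only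
    rw [hcop, (hinv _ _).1, (hinv _ _).2, (hinv _ _).1, (hinv _ _).2]
    exact ⟨y.1.2.1, y.2.2.1⟩
  · exact hback _ _ _ _ y.1.2.2 y.2.2.2
  · obtain ⟨⟨v, l⟩, hv, hl⟩ := q
    apply Subtype.ext
    simp only
    refine Prod.ext (funext fun i => ?_) (Units.ext ?_)
    · show e.symm (fS (v i), fT (v i)) = v i
      rw [← he, e.symm_apply_apply]
    · show e.symm (fS l, fT l) = l
      rw [← he, e.symm_apply_apply]
  · obtain ⟨⟨⟨w₁, l₁⟩, hw₁, hl₁⟩, ⟨⟨w₂, l₂⟩, hw₂, hl₂⟩⟩ := y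
    simp only
    refine Prod.ext (Subtype.ext (Prod.ext (funext fun i => (hinv _ _).1) (Units.ext (hinv _ _).1)))
      (Subtype.ext (Prod.ext (funext fun i => (hinv _ _).2) (Units.ext (hinv _ _).2)))

/-- **Chinese remainder theorem for eigen-pairs modulo `m n`, `(m, n) = 1`.** [folklore] -/
theorem eigPairs_zmod_mul {m n : ℕ} (h : m.Coprime n) (A : Matrix (Fin 2) (Fin 2) ℤ) :
    eigPairs (ZMod (m * n)) (A.map (Int.cast : ℤ → ZMod (m * n))) =
      eigPairs (ZMod m) (A.map (Int.cast : ℤ → ZMod m)) *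
        eigPairs (ZMod n) (A.map (Int.cast : ℤ → ZMod n)) :=
  eigPairs_of_ringEquiv_prod (ZMod.chineseRemainder h) A

/-- Modulo `1` there is exactly one eigen-pair. [folklore] -/
theorem eigPairs_zmod_one (A : Matrix (Fin 2) (Fin 2) ℤ) :
    eigPairs (ZMod 1) (A.map (Int.cast : ℤ → ZMod 1)) = 1 := by
  unfold eigPairs
  rw [Nat.card_eq_one_iff_unique]
  refine ⟨⟨fun x y => Subtype.ext (Prod.ext (funext fun i => Subsingleton.elim _ _)
    (Units.ext (Subsingleton.elim _ _)))⟩, ⟨⟨(0, 1), ?_, funext fun i => Subsingleton.elim _ _⟩⟩⟩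
  exact ⟨0, 0, Subsingleton.elim _ _⟩

end CRT

/-! ### Fixed points on `X = SL₂(ℤ)/Γ₀(N)` and eigen-pairs modulo `N` -/

section Global

variable (N : ℕ) [NeZero N]

/-- The number of fixed points of `q ↦ q · adj M` (i.e. of `[M̄]` on `ℙ¹(ℤ/Nℤ)`) on
`X = SL₂(ℤ)/Γ₀(N)`. [cite: Popa2014, §2 (tr V|M)] -/
def fixCount (M : Matrix (Fin 2) (Fin 2) ℤ) : ℕ :=
  Nat.card {q : Gamma0Coset N // actP N q (adjugate M) = q}

/-- `fixCount` through `ℙ¹(ℤ/Nℤ)`. [folklore] -/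
theorem fixCount_eq_card_P1 (M : Matrix (Fin 2) (Fin 2) ℤ) :
    fixCount N M = Nat.card {x : P1 N // smulP1 N M x = x} :=
  Nat.card_congr ((cosetEquivP1 N).subtypeEquiv fun q => by
    rw [← cosetEquivP1_actP_adjugate, (cosetEquivP1 N).apply_eq_iff_eq])

/-- Unimodular columns modulo `N` form a finite set. [folklore] -/
instance : Finite (UniCol N) := by
  unfold UniCol; infer_instance

/-- `ℙ¹(ℤ/Nℤ)` is finite. [folklore] -/
instance : Finite (P1 N) := Finite.of_equiv _ (cosetEquivP1 N)

variable {N}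

omit [NeZero N] in
/-- The unit group acts freely on unimodular columns. [folklore] -/
theorem UniCol.smul_left_injective (v : UniCol N) {u u' : (ZMod N)ˣ} (h : u • v = u' • v) : u = u' := by
  obtain ⟨a, b, hab⟩ := v.2
  have h0 : (u : ZMod N) * v.1 0 = u' * v.1 0 := by
    simpa [Units.smul_def] using congrArg (fun w : UniCol N => w.1 0) h
  have h1 : (u : ZMod N) * v.1 1 = u' * v.1 1 := by
    simpa [Units.smul_def] using congrArg (fun w : UniCol N => w.1 1) h
  apply Units.ext
  linear_combination (↑u' - ↑u : ZMod N) * hab + a * h0 + b * h1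

omit [NeZero N] in
/-- A class `[v]` is fixed by `[M̄]` iff `v` is an eigenvector: `M̄ v = λ v` for a unit `λ`.
[folklore] -/
theorem smulP1_mk_eq_iff {M : Matrix (Fin 2) (Fin 2) ℤ} (hM : IsUnit (redMat N M).det) (v : UniCol N) :
    smulP1 N M (P1.mk v) = P1.mk v ↔ ∃ l : (ZMod N)ˣ, redMat N M *ᵥ v.1 = (l : ZMod N) • v.1 := by
  rw [smulP1_mk N hM, P1.mk_eq_mk_iff, ← UniCol.exists_smul_eq_iff]
  constructor
  · rintro ⟨u, hu⟩
    refine ⟨u⁻¹, ?_⟩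
    have hu' : ((u • UniCol.mulVec hM v : UniCol N)).1 = v.1 := congrArg Subtype.val hu
    have hu'' : (u : ZMod N) • (redMat N M *ᵥ v.1) = v.1 := hu'
    calc redMat N M *ᵥ v.1 = ((u⁻¹ : (ZMod N)ˣ) : ZMod N) • ((u : ZMod N) • (redMat N M *ᵥ v.1)) := by
          rw [smul_smul, Units.inv_mul, one_smul]
      _ = _ := by rw [hu'']
  · rintro ⟨l, hl⟩
    refine ⟨l⁻¹, Subtype.ext ?_⟩
    show ((l⁻¹ : (ZMod N)ˣ) : ZMod N) • (redMat N M *ᵥ v.1) = v.1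
    rw [hl, smul_smul, Units.inv_mul, one_smul]

/-- **`φ(N) · Fix_N(M) = eigPairs`**: the eigenvector columns are the full preimage of the fixed
classes, on which `(ℤ/Nℤ)ˣ` acts freely, and an eigenvector has a unique eigenvalue.
[folklore] -/
theorem totient_mul_card_fixed {M : Matrix (Fin 2) (Fin 2) ℤ} (hM : IsUnit (redMat N M).det) :
    N.totient * Nat.card {x : P1 N // smulP1 N M x = x} = eigPairs (ZMod N) (redMat N M) := by
  classical
  -- eigenvector columns
  let S : Type := {v : UniCol N // ∃ l : (ZMod N)ˣ, redMat N M *ᵥ v.1 = (l : ZMod N) • v.1}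
  let X : Type := {x : P1 N // smulP1 N M x = x}
  haveI : Finite S := Subtype.finite
  haveI : Fintype X := Fintype.ofFinite X
  haveI : Fintype S := Fintype.ofFinite S
  -- (1) `S ≃ eigen-pairs`
  have hS : Nat.card S = eigPairs (ZMod N) (redMat N M) := by
    unfold eigPairs
    symm
    refine Nat.card_eq_of_bijective
      (fun q => ⟨⟨q.1.1, q.2.1⟩, q.1.2, q.2.2⟩) ⟨fun q q' h => ?_, fun w => ?_⟩
    · have hv : q.1.1 = q'.1.1 := congrArg (fun w : S => w.1.1) h
      apply Subtype.ext
      refine Prod.ext hv (Units.ext ?_)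
      obtain ⟨a, b, hab⟩ := q.2.1
      have e1 := q.2.2
      have e2 := q'.2.2
      rw [← hv] at e2
      rw [e1] at e2
      have h0 := congrFun e2 0
      have h1 := congrFun e2 1
      simp only [Pi.smul_apply, smul_eq_mul] at h0 h1
      linear_combination (↑q'.1.2 - ↑q.1.2 : ZMod N) * hab + a * h0 + b * h1
    · obtain ⟨v, l, hl⟩ := w
      exact ⟨⟨(v.1, l), v.2, hl⟩, rfl⟩
  -- (2) fibres of `S → X` are free `(ℤ/Nℤ)ˣ`-orbits
  let π : S → X := fun v => ⟨P1.mk v.1, (smulP1_mk_eq_iff hM v.1).mpr v.2⟩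
  have hfib : ∀ x : X, Nat.card {v : S // π v = x} = N.totient := by
    intro x
    obtain ⟨v₀, hv₀⟩ := P1.mk_surjective x.1
    have hv₀S : ∃ l : (ZMod N)ˣ, redMat N M *ᵥ v₀.1 = (l : ZMod N) • v₀.1 :=
      (smulP1_mk_eq_iff hM v₀).mp (by rw [hv₀]; exact x.2)
    rw [← ZMod.card_units_eq_totient N, ← Nat.card_eq_fintype_card]
    symm
    refine Nat.card_eq_of_bijective (fun u => ⟨⟨u • v₀, ?_⟩, ?_⟩) ⟨fun u u' h => ?_, fun w => ?_⟩
    · obtain ⟨l, hl⟩ := hv₀S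
      refine ⟨l, ?_⟩
      show redMat N M *ᵥ ((u : ZMod N) • v₀.1) = (l : ZMod N) • ((u : ZMod N) • v₀.1)
      rw [Matrix.mulVec_smul, hl, smul_comm]
    · apply Subtype.ext
      show P1.mk (u • v₀) = x.1
      rw [← hv₀, P1.mk_eq_mk_iff, ← UniCol.exists_smul_eq_iff]
      exact ⟨u⁻¹, inv_smul_smul u v₀⟩
    · exact UniCol.smul_left_injective v₀ (congrArg (fun w : {v : S // π v = x} => w.1.1) h)
    · obtain ⟨⟨w, hwS⟩, hw⟩ := w
      have hw' : P1.mk v₀ = P1.mk w := by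
        rw [hv₀]; exact (congrArg Subtype.val hw).symm
      obtain ⟨u, hu⟩ := (UniCol.exists_smul_eq_iff v₀ w).mpr ((P1.mk_eq_mk_iff v₀ w).mp hw')
      exact ⟨u, Subtype.ext (Subtype.ext hu)⟩
  -- (3) count
  have h3 : Nat.card S = ∑ y : X, Nat.card {v : S // π v = y} := by
    rw [Nat.card_congr (Equiv.sigmaFiberEquiv π).symm, Nat.card_eq_fintype_card, Fintype.card_sigma]
    exact Finset.sum_congr rfl fun y _ => Nat.card_eq_fintype_card.symm
  rw [← hS, h3, Finset.sum_congr rfl fun y _ => hfib y, Finset.sum_const, Finset.card_univ, smul_eq_mul,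
    Nat.card_eq_fintype_card, mul_comm]

/-- **`φ(N) · Fix_N(M) = eigPairs (ℤ/Nℤ) M̄`** on `X = SL₂(ℤ)/Γ₀(N)`. [folklore] -/
theorem totient_mul_fixCount {M : Matrix (Fin 2) (Fin 2) ℤ} (hM : IsUnit (redMat N M).det) :
    N.totient * fixCount N M = eigPairs (ZMod N) (redMat N M) := by
  rw [fixCount_eq_card_P1, totient_mul_card_fixed hM]

end Global

/-! ### The product formula at squarefree level -/

section Squarefree

/-- The local factor `r_ℓ(tr M, det M) · (ℓ + 1 if M ≡ scalar (mod ℓ), else 1)` of the fixed-point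
count. [cite: SchoofVandervlugt1991, Thm. 2.2] -/
def localFix (ℓ : ℕ) (M : Matrix (Fin 2) (Fin 2) ℤ) : ℕ :=
  rootCount (ZMod ℓ) ((M 0 0 + M 1 1 : ℤ) : ZMod ℓ) ((M.det : ℤ) : ZMod ℓ) *
    (if (ℓ : ℤ) ∣ M 1 0 ∧ (ℓ : ℤ) ∣ M 0 1 ∧ (ℓ : ℤ) ∣ M 0 0 - M 1 1 then ℓ + 1 else 1)

/-- Eigen-pairs modulo a prime `ℓ ∤ det M`: `(ℓ − 1) · localFix ℓ M`. [folklore] -/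
theorem eigPairs_zmod_prime {ℓ : ℕ} (hℓ : ℓ.Prime) (M : Matrix (Fin 2) (Fin 2) ℤ)
    (hM : ¬ (ℓ : ℤ) ∣ M.det) :
    eigPairs (ZMod ℓ) (M.map (Int.cast : ℤ → ZMod ℓ)) = (ℓ - 1) * localFix ℓ M := by
  haveI := Fact.mk hℓ
  have hdet : (M.map (Int.cast : ℤ → ZMod ℓ)).det = ((M.det : ℤ) : ZMod ℓ) := by
    simp [Matrix.det_fin_two]
  have hA : (M.map (Int.cast : ℤ → ZMod ℓ)).det ≠ 0 := by
    rw [hdet, Ne, ZMod.intCast_zmod_eq_zero_iff_dvd]; exact hM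
  rw [eigPairs_prime _ hA, affFix_eq, localFix, hdet]
  congr 2
  · simp
  · simp only [Matrix.map_apply, ZMod.intCast_zmod_eq_zero_iff_dvd, ZMod.intCast_eq_intCast_iff_dvd_sub]
    by_cases h1 : (ℓ : ℤ) ∣ M 1 0 <;> by_cases h2 : (ℓ : ℤ) ∣ M 0 1 <;>
      by_cases h3 : (ℓ : ℤ) ∣ M 0 0 - M 1 1 <;>
      simp [h1, h2, h3, dvd_sub_comm]

/-- Eigen-pairs modulo a squarefree `N` prime to `det M`: the product of the local factors.
[folklore] -/
theorem eigPairs_zmod_squarefree : ∀ {N : ℕ}, Squarefree N → ∀ (M : Matrix (Fin 2) (Fin 2) ℤ),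
    IsCoprime M.det (N : ℤ) →
    eigPairs (ZMod N) (M.map (Int.cast : ℤ → ZMod N)) = ∏ ℓ ∈ N.primeFactors, (ℓ - 1) * localFix ℓ M := by
  intro N
  induction N using Nat.recOnPosPrimePosCoprime with
  | zero => exact fun h => absurd h not_squarefree_zero
  | one => intro _ M _; rw [Nat.primeFactors_one, Finset.prod_empty, eigPairs_zmod_one]
  | prime_pow p k hp hk =>
    intro hsq M hcop
    have hk1 : k = 1 := by
      rcases (Nat.squarefree_pow_iff hp.ne_one hk.ne').mp hsq with ⟨-, h⟩
      exact h
    subst hk1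
    rw [pow_one] at hcop ⊢
    rw [Nat.Prime.primeFactors hp, Finset.prod_singleton]
    refine eigPairs_zmod_prime hp M fun h => ?_
    have := Int.isCoprime_iff_gcd_eq_one.mp hcop
    have hpd : p ∣ Int.gcd M.det p := Int.dvd_gcd h dvd_rfl
    rw [this] at hpd
    exact hp.ne_one (Nat.eq_one_of_dvd_one hpd)
  | coprime m n hm hn hmn ihm ihn =>
    intro hsq M hcop
    have hsqm : Squarefree m := (Nat.squarefree_mul_iff.mp hsq).2.1
    have hsqn : Squarefree n := (Nat.squarefree_mul_iff.mp hsq).2.2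
    have hcm : IsCoprime M.det (m : ℤ) :=
      hcop.of_isCoprime_of_dvd_right (by exact_mod_cast dvd_mul_right m n)
    have hcn : IsCoprime M.det (n : ℤ) :=
      hcop.of_isCoprime_of_dvd_right (by exact_mod_cast dvd_mul_left n m)
    rw [eigPairs_zmod_mul hmn, ihm hsqm M hcm, ihn hsqn M hcn, Nat.Coprime.primeFactors_mul hmn,
      Finset.prod_union hmn.disjoint_primeFactors]

/-- `φ(N) = ∏_{ℓ ∣ N} (ℓ − 1)` for squarefree `N`. [folklore] -/
theorem totient_eq_prod_of_squarefree : ∀ {N : ℕ}, Squarefree N →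
    N.totient = ∏ ℓ ∈ N.primeFactors, (ℓ - 1) := by
  intro N
  induction N using Nat.recOnPosPrimePosCoprime with
  | zero => exact fun h => absurd h not_squarefree_zero
  | one => intro; simp
  | prime_pow p k hp hk =>
    intro hsq
    have hk1 : k = 1 := by
      rcases (Nat.squarefree_pow_iff hp.ne_one hk.ne').mp hsq with ⟨-, h⟩
      exact h
    subst hk1
    rw [pow_one, Nat.Prime.primeFactors hp, Finset.prod_singleton, Nat.totient_prime hp]
  | coprime m n hm hn hmn ihm ihn =>
    intro hsq
    rw [Nat.totient_mul hmn, ihm (Nat.squarefree_mul_iff.mp hsq).2.1,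
      ihn (Nat.squarefree_mul_iff.mp hsq).2.2, Nat.Coprime.primeFactors_mul hmn,
      Finset.prod_union hmn.disjoint_primeFactors]

/-- **The fixed-point count at squarefree level**:
`Fix_N(M) = ∏_{ℓ ∣ N} r_ℓ(tr M, det M) · (ℓ + 1 if M ≡ scalar (mod ℓ), else 1)` for
`(det M, N) = 1`. [cite: SchoofVandervlugt1991, Thm. 2.2; Popa2014, §2] -/
theorem fixCount_eq_prod {N : ℕ} [NeZero N] (hN : Squarefree N) (M : Matrix (Fin 2) (Fin 2) ℤ)
    (hM : IsCoprime M.det (N : ℤ)) :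
    fixCount N M = ∏ ℓ ∈ N.primeFactors, localFix ℓ M := by
  have hunit : IsUnit (redMat N M).det := by
    rw [isUnit_det_redMat_iff]
    exact (ZMod.coe_int_isUnit_iff_isCoprime _ _).mpr hM.symm
  have h := totient_mul_fixCount hunit
  rw [show redMat N M = M.map (Int.cast : ℤ → ZMod N) from rfl, eigPairs_zmod_squarefree hN M hM,
    Finset.prod_mul_distrib, ← totient_eq_prod_of_squarefree hN] at h
  exact Nat.eq_of_mul_eq_mul_left (Nat.totient_pos.mpr (NeZero.pos N)) h

end Squarefree

end Literature.NumberTheory.EllipticCurves.ModularForms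

end
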